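import Literature.MathematicalPhysics.QuantumLattice.LiebWuFillingContinuity
import HarnessLib

/-!
# The Lieb–Wu energy as a function of the density (`B = ∞`)

Family `hubbard`. Lieb–Wu, PRL 20 (1968) 1445, p. 1446: (13) and (14) "are to be solved for the
distribution functions ρ(k) and σ(Λ) subject to (15)–(16)", `∫_{-Q}^{Q} ρ = N/N_a`, and then (17) gives
the energy — i.e. the printed ground-state energy is a FUNCTION of the density `n = N/N_a` (at `B = ∞`,
`S_z = 0`, statement (b)), the cutoff `Q` being determined by `n` (statement (c): `N/N_a` strictly
increasing in `Q` = Lieb–Wu 2003, Theorem 3, whose `Q > π/2` half rests on Lemma 3 and is not vendored).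

With `LiebWuFillingContinuity` (every density `0 < n ≤ 1` is attained, the filling is continuous in
`Q`) this file DEFINES that function without assuming Theorem 3:

* `liebWuCutoffAtFilling U n := sSup {Q ∈ (0, π] | liebWuFillingAtCutoff U Q = n}` — the largest
  cutoff with filling `n` (THE cutoff, once Theorem 3 is available; the choice `sSup` makes `n = 1 ↦ π`
  hold by `liebWuFillingAtCutoff_pi` alone);
* `liebWuEnergyAtFilling U n := liebWuEnergyAtCutoff U (liebWuCutoffAtFilling U n)` — eq. (17) there;

and PROVES, for `U > 0` and `0 < n ≤ 1`: the cutoff lies in `[πn/2, π]` and HAS filling `n`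
(`liebWuCutoffAtFilling_spec`: the level set is closed, nonempty, bounded), hence
`isLiebWuEnergyAt_liebWuEnergyAtFilling : IsLiebWuEnergyAt U n (liebWuEnergyAtFilling U n)`; and at
`n = 1`: cutoff `π`, energy `liebWuEnergy U` = eq. (20) (`liebWuEnergyAtFilling_one`). The identification
of `liebWuEnergyAtFilling U n` with the Hubbard chain's ground-state energy density at density `n` is
Lieb–Wu's announcement (no complete published proof; cf. the tree's named fact `lieb_wu` at `n = 1`) and
is NOT asserted here. No named fact.

## References

* E. H. Lieb, F. Y. Wu, Phys. Rev. Lett. 20 (1968) 1445, eqs. (15)–(17), (20), statements (b)–(c)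
  (key `LiebWuPRL1968`); Physica A 321 (2003) 1 = arXiv:cond-mat/0207529, §5, Theorem 3
  (key `LiebWuPhysicaA2003`).
-/

noncomputable section

open Set Real Literature.Analysis.FunctionSpaces

namespace Literature.MathematicalPhysics.QuantumLattice

/-- **The cutoff `Q(n)` at density `n`:** the largest `Q ∈ (0, π]` whose `B = ∞` solution has filling
`N/N_a = n` (for `0 < n ≤ 1` and `U > 0` such `Q` exist, `exists_liebWuFillingAtCutoff_eq`; by Lieb–Wu
2003, Theorem 3 — not vendored — it is unique). [cite: LiebWuPRL1968, eq. (15) and statement (c)] -/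
def liebWuCutoffAtFilling (U n : ℝ) : ℝ :=
  sSup {Q : ℝ | Q ∈ Ioc (0 : ℝ) π ∧ liebWuFillingAtCutoff U Q = n}

/-- **The Lieb–Wu ground-state energy per site at density `n`** (`B = ∞`, i.e. `S_z = 0`): eq. (17)
evaluated on the solution of (13)–(14) whose cutoff is fixed by (15), `∫_{-Q}^{Q} ρ = n`.
[cite: LiebWuPRL1968, eqs. (15), (17)] -/
def liebWuEnergyAtFilling (U n : ℝ) : ℝ :=
  liebWuEnergyAtCutoff U (liebWuCutoffAtFilling U n)

section EnergyAtFilling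

variable {U n : ℝ}

/-- The level set `{Q ∈ (0, π] | N/N_a(Q) = n}` is `{Q ∈ [πn/2, π] | N/N_a(Q) = n}` (`N/N_a ≤ 2Q/π`).
[cite: LiebWuPhysicaA2003, §5, Theorems 1–3] -/
theorem liebWuFilling_levelSet_eq (hU : 0 < U) (hn : 0 < n) :
    {Q : ℝ | Q ∈ Ioc (0 : ℝ) π ∧ liebWuFillingAtCutoff U Q = n} =
      Icc (π * n / 2) π ∩ liebWuFillingAtCutoff U ⁻¹' {n} := by
  have hπ := Real.pi_pos
  ext Q
  simp only [mem_setOf_eq, mem_inter_iff, mem_Icc, mem_Ioc, mem_preimage, mem_singleton_iff]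
  constructor
  · rintro ⟨⟨hQ0, hQπ⟩, hQn⟩
    refine ⟨⟨?_, hQπ⟩, hQn⟩
    have h := (liebWuFillingAtCutoff_mem_Icc hU hQ0 hQπ).2
    rw [hQn, le_div_iff₀ hπ] at h
    linarith
  · rintro ⟨⟨hQ0, hQπ⟩, hQn⟩
    exact ⟨⟨lt_of_lt_of_le (by positivity) hQ0, hQπ⟩, hQn⟩

/-- **`Q(n)` is a cutoff with filling `n`:** `Q(n) ∈ [πn/2, π] ⊆ (0, π]` and `N/N_a(Q(n)) = n`
(`0 < n ≤ 1`, `U > 0`): the level set is closed (continuity of the filling), nonempty (every density is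
attained) and bounded, so it contains its supremum. [cite: LiebWuPhysicaA2003, §5, Theorem 3] -/
theorem liebWuCutoffAtFilling_spec (hU : 0 < U) (hn : n ∈ Ioc (0 : ℝ) 1) :
    liebWuCutoffAtFilling U n ∈ Icc (π * n / 2) π ∧
      liebWuFillingAtCutoff U (liebWuCutoffAtFilling U n) = n := by
  have hπ := Real.pi_pos
  have hn0 := hn.1
  have hset := liebWuFilling_levelSet_eq hU hn0
  have hclosed : IsClosed {Q : ℝ | Q ∈ Ioc (0 : ℝ) π ∧ liebWuFillingAtCutoff U Q = n} := by
    rw [hset]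
    exact ((continuousOn_liebWuFillingAtCutoff hU).mono fun Q hQ =>
      ⟨lt_of_lt_of_le (by positivity) hQ.1, hQ.2⟩).preimage_isClosed_of_isClosed isClosed_Icc
        isClosed_singleton
  have hne : {Q : ℝ | Q ∈ Ioc (0 : ℝ) π ∧ liebWuFillingAtCutoff U Q = n}.Nonempty := by
    obtain ⟨Q, hQ, hQn⟩ := exists_liebWuFillingAtCutoff_eq hU hn
    exact ⟨Q, hQ, hQn⟩
  have hbdd : BddAbove {Q : ℝ | Q ∈ Ioc (0 : ℝ) π ∧ liebWuFillingAtCutoff U Q = n} :=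
    ⟨π, fun Q hQ => hQ.1.2⟩
  have hmem := hclosed.csSup_mem hne hbdd
  unfold liebWuCutoffAtFilling
  have hmem' : sSup {Q : ℝ | Q ∈ Ioc (0 : ℝ) π ∧ liebWuFillingAtCutoff U Q = n} ∈
      Icc (π * n / 2) π ∩ liebWuFillingAtCutoff U ⁻¹' {n} := hset ▸ hmem
  simpa only [mem_inter_iff, mem_preimage, mem_singleton_iff] using hmem'

/-- `Q(n) ∈ (0, π]`. [cite: LiebWuPhysicaA2003, §5, Theorem 3] -/
theorem liebWuCutoffAtFilling_mem_Ioc (hU : 0 < U) (hn : n ∈ Ioc (0 : ℝ) 1) :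
    liebWuCutoffAtFilling U n ∈ Ioc (0 : ℝ) π := by
  obtain ⟨⟨h1, h2⟩, -⟩ := liebWuCutoffAtFilling_spec hU hn
  have : 0 < π * n / 2 := by have := hn.1; positivity
  exact ⟨this.trans_le h1, h2⟩

/-- **`liebWuEnergyAtFilling U n` is a Lieb–Wu energy at filling `n`** in the sense of
`IsLiebWuEnergyAt` (`U > 0`, `0 < n ≤ 1`). [cite: LiebWuPRL1968, eqs. (15), (17), statements (a)–(c)] -/
theorem isLiebWuEnergyAt_liebWuEnergyAtFilling (hU : 0 < U) (hn : n ∈ Ioc (0 : ℝ) 1) :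
    IsLiebWuEnergyAt U n (liebWuEnergyAtFilling U n) := by
  obtain ⟨hQ0, hQπ⟩ := liebWuCutoffAtFilling_mem_Ioc hU hn
  exact (isLiebWuEnergyAt_iff_cutoff hU).2
    ⟨liebWuCutoffAtFilling U n, hQ0, hQπ, (liebWuCutoffAtFilling_spec hU hn).2, rfl⟩

/-- **At half filling the cutoff is `π`** (`N/N_a(π) = 1` and `Q(n) ≤ π`). [cite: LiebWuPRL1968, statement (c)] -/
theorem liebWuCutoffAtFilling_one (hU : 0 < U) : liebWuCutoffAtFilling U 1 = π := by
  have h1 : (1 : ℝ) ∈ Ioc (0 : ℝ) 1 := ⟨one_pos, le_rfl⟩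
  refine le_antisymm (liebWuCutoffAtFilling_spec hU h1).1.2 ?_
  unfold liebWuCutoffAtFilling
  exact le_csSup ⟨π, fun Q hQ => hQ.1.2⟩ ⟨⟨Real.pi_pos, le_rfl⟩, liebWuFillingAtCutoff_pi hU⟩

/-- **At half filling the energy is eq. (20):** `liebWuEnergyAtFilling U 1 = liebWuEnergy U =
-4∫₀^∞ J₀(ω)J₁(ω) dω / (ω(1 + e^{ωU/2}))`. [cite: LiebWuPRL1968, eq. (20)] -/
theorem liebWuEnergyAtFilling_one (hU : 0 < U) : liebWuEnergyAtFilling U 1 = liebWuEnergy U := by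
  rw [liebWuEnergyAtFilling, liebWuCutoffAtFilling_one hU, liebWuEnergyAtCutoff_pi hU]

end EnergyAtFilling

end Literature.MathematicalPhysics.QuantumLattice

end
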